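import Mathlib
import HarnessLib

/-!
# The Dobrushin–Pechersky two-parameter contraction: powers of the `2 × 2` matrix `M(K)`,
# its Perron root, and the `T = diag(ξ, 1)` conjugation with equal row sums
# (Conache–Kondratiev–Kozitsky–Pasurek 2015, (28a), (srM), (dc11))

[topic Probability/TransportMaps]

D. Conache, Yu. Kondratiev, Yu. Kozitsky, T. Pasurek, *Gibbs Fields: Uniqueness and Decay of
Correlations. Revisiting Dobrushin and Pechersky*, arXiv:1501.00673 (2015) [ConacheEtAl2015] — the
refined proof of the Dobrushin–Pechersky criterion [DobrushinPechersky1983]. After the one-sweep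
estimates of Lemma 3.7,
(27) `γ(ν) ≤ [κ̄ + AK⁻¹] γ(ν₀) + 2AK⁻¹ λ(ν₀)`, (28) `λ(ν) ≤ Δ^{χ−1} γ(ν₀) + c̄ Δ^χ λ(ν₀)`,
the proof of Theorem 2.6 iterates (§3.3, (28a), verbatim): «we repeat this due times and obtain
`ν̂ₙ ∈ 𝒞(μ₁, μ₂)` such that `(γ(ν̂ₙ), λ(ν̂ₙ))ᵀ ≤ [M(K)]ⁿ (γ(ν₀), λ(ν₀))ᵀ`, where `M(K)` is the matrix
defined by the right-hand sides of (27) and (28). Its spectral radius is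
(srM) `r_K = ½ [κ̄ + AK⁻¹ + c̄Δ^χ + √((κ̄ + AK⁻¹ − c̄Δ^χ)² + 8 Δ^χ AK⁻¹)]`. For `K > K_*` … we have
`r_K < 1`, which by (28a) yields (18)», and the proof of Theorem 2.7 (§3.4, (dc11)–(dc12), verbatim):
«Set `ξ = Δ^{χ−1}/(r_K − c̄Δ^χ) = (r_K − κ̄ − AK⁻¹)/(2AK⁻¹) > 0`, and let `T` be the `2 × 2` diagonal
matrix with `T₁₁ = ξ` and `T₂₂ = 1`. Then the matrix `M̃(K) := T M(K) T⁻¹` … is positive and such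
that both its rows sum up to `r_K`. Set `ṽₛ = T vₛ` … `‖ṽₛ‖ := max{ṽₛ¹; ṽₛ²} ≤ ‖M̃(K)‖ ‖ṽₛ₋₁‖ =
r_K max{ṽₛ₋₁¹; ṽₛ₋₁²}`, which yields
(dc12) `γ_{D₀}(ν^x_{N−1}) ≤ r_K^{N−1} max{γ_{D_{N−1}}(ν₀^x); ξ⁻¹ λ_{D_{N−1}}(ν₀^x)}`.»

THIS FILE isolates that linear algebra, for an arbitrary nonnegative `2 × 2` matrix `[[a, b], [c, d]]`
(so that it serves the printed `M(K)` as well as any corrected or sharpened variant of (27)–(28)):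

* `max_step_le` — ONE step of the `T = diag(ξ, 1)` trick in `ℝ≥0∞`: if `a + ξ b ≤ r` and
  `c + ξ d ≤ ξ r` (the two row sums of `T M T⁻¹`, cleared of the division by `ξ`), then
  `γ' ≤ aγ + bλ`, `λ' ≤ cγ + dλ` imply `max(ξγ', λ') ≤ r · max(ξγ, λ)`;
* `max_iterate_le`, `fst_iterate_le` (= the shape of (dc12): `γₙ ≤ rⁿ max{γ₀, ξ⁻¹λ₀}`),
  `snd_iterate_le` — the `n`-step bounds for sequences obeying the two recursive inequalities;
* `perronRoot a b c d = ½[a + d + √((a − d)² + 4bc)]` (the shape of (srM)) with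
  `perronRoot_sub_mul_sub` (`(r − a)(r − d) = bc`), `le_perronRoot_fst/snd`, the conjugating weight
  `perronXi = (r − a)/b` with the two row-sum identities `fst_row_perronXi`, `snd_row_perronXi`
  (the printed «both its rows sum up to `r_K`»), and `perronRoot_lt_one_iff`
  (`r < 1 ↔ a < 1 ∧ d < 1 ∧ bc < (1 − a)(1 − d)` — the algebra behind the threshold `K_*` of (K));
* `exists_weight_of_perronRoot` — packaging: for `a, b, c, d : ℝ≥0` with `0 < b`, `0 < c` there is a
  weight `ξ > 0` with `a + ξ b = r` and `c + ξ d = ξ r`, `r = perronRoot`, ready for `max_step_le`.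

Remark on the printed constants (records of the pub-ymgap cell, `HOME/ym3ir/AS-PRINTED.md` §11 /
§13, erratum candidate E-DP-1): (28) prints the second row `(Δ^{χ−1}, c̄Δ^χ)`, (srM)'s discriminant
term `8Δ^χ AK⁻¹` corresponds to a second-row entry `Δ^χ`, and the induction (41)–(42) of §4 reaches
level `χ` after the `χ`-th colour class, i.e. `(Δ^χ, c̄Δ^{χ+1})` (see
`Literature/Probability/TransportMaps/DobrushinPecherskySweep.lean`). Everything here is stated for a
general `[[a, b], [c, d]]`, so it is insensitive to which row is plugged in.

Scope (honest): finite-dimensional linear algebra only; no measures, no specifications; nothing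
about lattice gauge theory, continuum limits or mass gaps. No named facts.

## References
* [ConacheEtAl2015] D. Conache, Yu. Kondratiev, Yu. Kozitsky, T. Pasurek, arXiv:1501.00673, §3.3
  (26a)–(28a), (srM); §3.4 (dc11)–(dc12), (constan). Statements quoted from the held TeX
  (`paper:arxiv-1501.00673`, pp. 9–11).
* [DobrushinPechersky1983] R. L. Dobrushin, E. A. Pechersky, LNM 1021 (1983) 97–110.
-/

noncomputable section

open scoped ENNReal NNReal

namespace Literature.Probability.TransportMaps

namespace DobrushinPecherskyContraction

/-! ### The `T = diag(ξ, 1)` trick in `ℝ≥0∞` -/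

section ENNReal

variable {a b c d r ξ : ℝ≥0∞}

/-- **One step of (dc11).** For a nonnegative `2 × 2` matrix `[[a, b], [c, d]]`, a weight
`0 < ξ < ∞` with `a + ξ b ≤ r` and `c + ξ d ≤ ξ r` (the two row sums of `T M T⁻¹`,
`T = diag(ξ, 1)`, are `≤ r`), and one step `γ' ≤ aγ + bλ`, `λ' ≤ cγ + dλ` of the recursion (28a):
`max(ξγ', λ') ≤ r · max(ξγ, λ)` («`‖ṽₛ‖ ≤ ‖M̃(K)‖ ‖ṽₛ₋₁‖ = r_K max{ṽₛ₋₁¹; ṽₛ₋₁²}`»).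
[cite: ConacheEtAl2015, §3.4 (dc11)] -/
theorem max_step_le (hξ0 : ξ ≠ 0) (hξt : ξ ≠ ∞) (hrow₁ : a + ξ * b ≤ r)
    (hrow₂ : c + ξ * d ≤ ξ * r) {γ l γ' l' : ℝ≥0∞} (hγ : γ' ≤ a * γ + b * l)
    (hl : l' ≤ c * γ + d * l) :
    max (ξ * γ') l' ≤ r * max (ξ * γ) l := by
  set u := max (ξ * γ) l with hu
  have h1 : ξ * γ ≤ u := le_max_left _ _
  have h2 : l ≤ u := le_max_right _ _
  refine max_le ?_ ?_
  · calc ξ * γ' ≤ ξ * (a * γ + b * l) := mul_le_mul' le_rfl hγ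
      _ = a * (ξ * γ) + ξ * b * l := by ring
      _ ≤ a * u + ξ * b * u := add_le_add (mul_le_mul' le_rfl h1) (mul_le_mul' le_rfl h2)
      _ = (a + ξ * b) * u := by ring
      _ ≤ r * u := mul_le_mul' hrow₁ le_rfl
  · have key : ξ * l' ≤ ξ * (r * u) :=
      calc ξ * l' ≤ ξ * (c * γ + d * l) := mul_le_mul' le_rfl hl
        _ = c * (ξ * γ) + ξ * d * l := by ring
        _ ≤ c * u + ξ * d * u := add_le_add (mul_le_mul' le_rfl h1) (mul_le_mul' le_rfl h2)
        _ = (c + ξ * d) * u := by ring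
        _ ≤ ξ * r * u := mul_le_mul' hrow₂ le_rfl
        _ = ξ * (r * u) := by ring
    exact (ENNReal.mul_le_mul_iff_right hξ0 hξt).1 key

/-- **(28a) iterated, in the `T`-norm.** For sequences with `γₙ₊₁ ≤ aγₙ + bλₙ`,
`λₙ₊₁ ≤ cγₙ + dλₙ`: `max(ξγₙ, λₙ) ≤ rⁿ · max(ξγ₀, λ₀)`. [cite: ConacheEtAl2015, §3.3 (28a); §3.4 (dc11)] -/
theorem max_iterate_le (hξ0 : ξ ≠ 0) (hξt : ξ ≠ ∞) (hrow₁ : a + ξ * b ≤ r)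
    (hrow₂ : c + ξ * d ≤ ξ * r) (γ l : ℕ → ℝ≥0∞) (hγ : ∀ n, γ (n + 1) ≤ a * γ n + b * l n)
    (hl : ∀ n, l (n + 1) ≤ c * γ n + d * l n) (n : ℕ) :
    max (ξ * γ n) (l n) ≤ r ^ n * max (ξ * γ 0) (l 0) := by
  induction n with
  | zero => simp
  | succ n ih =>
    calc max (ξ * γ (n + 1)) (l (n + 1)) ≤ r * max (ξ * γ n) (l n) :=
          max_step_le hξ0 hξt hrow₁ hrow₂ (hγ n) (hl n)
      _ ≤ r * (r ^ n * max (ξ * γ 0) (l 0)) := mul_le_mul' le_rfl ih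
      _ = r ^ (n + 1) * max (ξ * γ 0) (l 0) := by ring

/-- **(dc12), first component:** `γₙ ≤ rⁿ · max{γ₀, ξ⁻¹ λ₀}`
(«`γ_{D₀}(ν^x_{N−1}) ≤ r_K^{N−1} max{γ_{D_{N−1}}(ν₀^x); ξ⁻¹ λ_{D_{N−1}}(ν₀^x)}`»).
[cite: ConacheEtAl2015, §3.4 (dc12)] -/
theorem fst_iterate_le (hξ0 : ξ ≠ 0) (hξt : ξ ≠ ∞) (hrow₁ : a + ξ * b ≤ r)
    (hrow₂ : c + ξ * d ≤ ξ * r) (γ l : ℕ → ℝ≥0∞) (hγ : ∀ n, γ (n + 1) ≤ a * γ n + b * l n)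
    (hl : ∀ n, l (n + 1) ≤ c * γ n + d * l n) (n : ℕ) :
    γ n ≤ r ^ n * max (γ 0) (ξ⁻¹ * l 0) := by
  have h := (max_le_iff.1 (max_iterate_le hξ0 hξt hrow₁ hrow₂ γ l hγ hl n)).1
  have hmax : max (ξ * γ 0) (l 0) = ξ * max (γ 0) (ξ⁻¹ * l 0) := by
    rw [mul_max, ← mul_assoc, ENNReal.mul_inv_cancel hξ0 hξt, one_mul]
  rw [hmax, ← mul_assoc, mul_comm (r ^ n) ξ, mul_assoc] at h
  exact (ENNReal.mul_le_mul_iff_right hξ0 hξt).1 h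

/-- **(dc12), second component:** `λₙ ≤ rⁿ · max{ξ γ₀, λ₀}`. [cite: ConacheEtAl2015, §3.4 (dc11)] -/
theorem snd_iterate_le (hξ0 : ξ ≠ 0) (hξt : ξ ≠ ∞) (hrow₁ : a + ξ * b ≤ r)
    (hrow₂ : c + ξ * d ≤ ξ * r) (γ l : ℕ → ℝ≥0∞) (hγ : ∀ n, γ (n + 1) ≤ a * γ n + b * l n)
    (hl : ∀ n, l (n + 1) ≤ c * γ n + d * l n) (n : ℕ) :
    l n ≤ r ^ n * max (ξ * γ 0) (l 0) :=
  (max_le_iff.1 (max_iterate_le hξ0 hξt hrow₁ hrow₂ γ l hγ hl n)).2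

/-- With `r < 1` both components tend to `0` (the use made of (28a) in the proof of Theorem 2.6:
«we have `r_K < 1`, which by (28a) yields (18)»), provided the initial data are finite.
[cite: ConacheEtAl2015, §3.3 proof of Theorem 2.6] -/
theorem tendsto_zero_of_lt_one (hξ0 : ξ ≠ 0) (hξt : ξ ≠ ∞) (hrow₁ : a + ξ * b ≤ r)
    (hrow₂ : c + ξ * d ≤ ξ * r) (hr : r < 1) (γ l : ℕ → ℝ≥0∞)
    (hγ : ∀ n, γ (n + 1) ≤ a * γ n + b * l n) (hl : ∀ n, l (n + 1) ≤ c * γ n + d * l n)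
    (hγ0 : γ 0 ≠ ∞) (hl0 : l 0 ≠ ∞) :
    Filter.Tendsto γ Filter.atTop (nhds 0) ∧ Filter.Tendsto l Filter.atTop (nhds 0) := by
  have hpow : Filter.Tendsto (fun n : ℕ => r ^ n) Filter.atTop (nhds 0) :=
    ENNReal.tendsto_pow_atTop_nhds_zero_of_lt_one hr
  have hM : max (ξ * γ 0) (l 0) ≠ ∞ := by
    simp [ENNReal.mul_eq_top, hξt, hγ0, hl0]
  have hM' : max (γ 0) (ξ⁻¹ * l 0) ≠ ∞ := by
    simp [ENNReal.mul_eq_top, ENNReal.inv_eq_top, hξ0, hγ0, hl0]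
  constructor
  · have h0 : Filter.Tendsto (fun n : ℕ => r ^ n * max (γ 0) (ξ⁻¹ * l 0)) Filter.atTop
        (nhds 0) := by
      simpa using ENNReal.Tendsto.mul_const hpow (Or.inr hM')
    exact tendsto_of_tendsto_of_tendsto_of_le_of_le tendsto_const_nhds h0 (fun _ => bot_le)
      fun n => fst_iterate_le hξ0 hξt hrow₁ hrow₂ γ l hγ hl n
  · have h0 : Filter.Tendsto (fun n : ℕ => r ^ n * max (ξ * γ 0) (l 0)) Filter.atTop
        (nhds 0) := by
      simpa using ENNReal.Tendsto.mul_const hpow (Or.inr hM)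
    exact tendsto_of_tendsto_of_tendsto_of_le_of_le tendsto_const_nhds h0 (fun _ => bot_le)
      fun n => snd_iterate_le hξ0 hξt hrow₁ hrow₂ γ l hγ hl n

end ENNReal

/-! ### The Perron root of a nonnegative `2 × 2` matrix and the conjugating weight -/

section Real

variable {a b c d : ℝ}

/-- The Perron root of `[[a, b], [c, d]]` (for `bc ≥ 0`): `r = ½ [a + d + √((a − d)² + 4bc)]` —
the shape of the printed (srM) `r_K = ½[κ̄ + AK⁻¹ + c̄Δ^χ + √((κ̄ + AK⁻¹ − c̄Δ^χ)² + 8Δ^χ AK⁻¹)]`.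
[cite: ConacheEtAl2015, §3.3 (srM)] -/
def perronRoot (a b c d : ℝ) : ℝ := (a + d + Real.sqrt ((a - d) ^ 2 + 4 * (b * c))) / 2

/-- The conjugating weight `ξ = (r − a)/b` (printed: `ξ = (r_K − κ̄ − AK⁻¹)/(2AK⁻¹)`).
[cite: ConacheEtAl2015, §3.4 (dc11)] -/
def perronXi (a b c d : ℝ) : ℝ := (perronRoot a b c d - a) / b

/-- The discriminant `(a − d)² + 4bc` is nonnegative. [folklore] -/
private theorem discr_nonneg (hbc : 0 ≤ b * c) : 0 ≤ (a - d) ^ 2 + 4 * (b * c) := by positivity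

/-- `|a − d| ≤ √((a − d)² + 4bc)`. [folklore] -/
private theorem abs_sub_le_sqrt_discr (hbc : 0 ≤ b * c) :
    |a - d| ≤ Real.sqrt ((a - d) ^ 2 + 4 * (b * c)) := by
  rw [← Real.sqrt_sq_eq_abs]
  exact Real.sqrt_le_sqrt (by linarith)

/-- `a ≤ r`. [cite: ConacheEtAl2015, §3.3 (srM)] -/
theorem le_perronRoot_fst (hbc : 0 ≤ b * c) : a ≤ perronRoot a b c d := by
  have h := abs_sub_le_sqrt_discr (a := a) (d := d) hbc
  have h' : a - d ≤ Real.sqrt ((a - d) ^ 2 + 4 * (b * c)) := (le_abs_self _).trans h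
  unfold perronRoot; linarith

/-- `d ≤ r`. [cite: ConacheEtAl2015, §3.3 (srM)] -/
theorem le_perronRoot_snd (hbc : 0 ≤ b * c) : d ≤ perronRoot a b c d := by
  have h := abs_sub_le_sqrt_discr (a := a) (d := d) hbc
  have h' : d - a ≤ Real.sqrt ((a - d) ^ 2 + 4 * (b * c)) := by
    rw [show d - a = -(a - d) by ring]; exact (neg_le_abs _).trans h
  unfold perronRoot; linarith

/-- The characteristic identity `(r − a)(r − d) = bc`. [cite: ConacheEtAl2015, §3.3 (srM)] -/
theorem perronRoot_sub_mul_sub (hbc : 0 ≤ b * c) :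
    (perronRoot a b c d - a) * (perronRoot a b c d - d) = b * c := by
  unfold perronRoot
  set s := Real.sqrt ((a - d) ^ 2 + 4 * (b * c)) with hs
  have hs2 : s * s = (a - d) ^ 2 + 4 * (b * c) := Real.mul_self_sqrt (discr_nonneg hbc)
  nlinarith [hs2]

/-- `a < r` as soon as `bc > 0`. [cite: ConacheEtAl2015, §3.4 («`ξ … > 0`»)] -/
theorem lt_perronRoot_fst (hbc : 0 < b * c) : a < perronRoot a b c d := by
  rcases (le_perronRoot_fst hbc.le).lt_or_eq with h | h
  · exact h
  · exfalso
    have := perronRoot_sub_mul_sub (a := a) (d := d) hbc.le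
    rw [← h, sub_self, zero_mul] at this
    exact absurd this.symm hbc.ne'

/-- `d < r` as soon as `bc > 0`. [cite: ConacheEtAl2015, §3.4] -/
theorem lt_perronRoot_snd (hbc : 0 < b * c) : d < perronRoot a b c d := by
  rcases (le_perronRoot_snd hbc.le).lt_or_eq with h | h
  · exact h
  · exfalso
    have := perronRoot_sub_mul_sub (a := a) (d := d) hbc.le
    rw [← h, sub_self, mul_zero] at this
    exact absurd this.symm hbc.ne'

/-- `ξ > 0` («`ξ = … > 0`»). [cite: ConacheEtAl2015, §3.4 (dc11)] -/
theorem perronXi_pos (hb : 0 < b) (hc : 0 < c) : 0 < perronXi a b c d :=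
  div_pos (sub_pos.2 (lt_perronRoot_fst (mul_pos hb hc))) hb

/-- First row of `T M T⁻¹` sums to `r`: `a + ξ b = r`. [cite: ConacheEtAl2015, §3.4 (dc11)] -/
theorem fst_row_perronXi (hb : b ≠ 0) : a + perronXi a b c d * b = perronRoot a b c d := by
  unfold perronXi; field_simp; ring

/-- Second row of `T M T⁻¹` sums to `r`: `c/ξ + d = r`, written as `c + ξ d = ξ r`
(«both its rows sum up to `r_K`»; equivalently `ξ = c/(r − d)`, the printed
`ξ = Δ^{χ−1}/(r_K − c̄Δ^χ)`). [cite: ConacheEtAl2015, §3.4 (dc11)] -/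
theorem snd_row_perronXi (hb : 0 < b) (hc : 0 < c) :
    c + perronXi a b c d * d = perronXi a b c d * perronRoot a b c d := by
  have key := perronRoot_sub_mul_sub (a := a) (d := d) (mul_pos hb hc).le
  unfold perronXi
  field_simp
  linear_combination -key

/-- **The threshold algebra behind `K_*`:** for a nonnegative matrix,
`r < 1 ↔ a < 1 ∧ d < 1 ∧ bc < (1 − a)(1 − d)`. (With the printed `M(K)`, the last condition is
`2AK⁻¹ Δ^{χ−1} < (1 − κ̄ − AK⁻¹)(1 − c̄Δ^χ)`, which is `K > K_*`'s second entry in (K).)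
[cite: ConacheEtAl2015, §2.2 (K); §3.3 (srM)] -/
theorem perronRoot_lt_one_iff (hbc : 0 ≤ b * c) :
    perronRoot a b c d < 1 ↔ a < 1 ∧ d < 1 ∧ b * c < (1 - a) * (1 - d) := by
  have key := perronRoot_sub_mul_sub (a := a) (d := d) hbc
  have ha := le_perronRoot_fst (a := a) (d := d) hbc
  have hd := le_perronRoot_snd (a := a) (d := d) hbc
  set r := perronRoot a b c d with hr
  constructor
  · intro h
    refine ⟨lt_of_le_of_lt ha h, lt_of_le_of_lt hd h, ?_⟩
    calc b * c = (r - a) * (r - d) := key.symm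
      _ < (1 - a) * (1 - d) := by
          have h1 : 0 ≤ r - a := sub_nonneg.2 ha
          have h2 : 0 ≤ r - d := sub_nonneg.2 hd
          have h3 : r - a < 1 - a := by linarith
          have h4 : r - d < 1 - d := by linarith
          calc (r - a) * (r - d) ≤ (r - a) * (1 - d) := by
                exact mul_le_mul_of_nonneg_left h4.le h1
            _ < (1 - a) * (1 - d) := by
                exact mul_lt_mul_of_pos_right h3 (by linarith)
  · rintro ⟨h1, h2, h3⟩
    by_contra hge
    push Not at hge
    have e1 : 1 - a ≤ r - a := by linarith
    have e2 : 1 - d ≤ r - d := by linarith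
    have : (1 - a) * (1 - d) ≤ (r - a) * (r - d) :=
      mul_le_mul e1 e2 (by linarith) (by linarith)
    linarith

end Real

/-! ### Packaging for `max_step_le`: the weight of the Perron root in `ℝ≥0` -/

/-- For `a, b, c, d : ℝ≥0` with `0 < b`, `0 < c`, the Perron root `r` and the weight `ξ` realise the
row conditions of `max_step_le` with EQUALITY: `a + ξ b = r`, `c + ξ d = ξ r`, `0 < ξ`
(«the matrix `M̃(K) := T M(K) T⁻¹` is positive and such that both its rows sum up to `r_K`»).
[cite: ConacheEtAl2015, §3.4 (dc11)] -/
theorem exists_weight_of_perronRoot (a b c d : ℝ≥0) (hb : 0 < b) (hc : 0 < c) :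
    ∃ r ξ : ℝ≥0, (r : ℝ) = perronRoot a b c d ∧ 0 < ξ ∧ a + ξ * b = r ∧ c + ξ * d = ξ * r := by
  have hbc : 0 < (b : ℝ) * c := mul_pos hb hc
  have hr0 : 0 ≤ perronRoot a b c d := (a.2).trans (le_perronRoot_fst hbc.le)
  have hξ0 : 0 < perronXi (a : ℝ) b c d := perronXi_pos hb hc
  refine ⟨⟨perronRoot a b c d, hr0⟩, ⟨perronXi a b c d, hξ0.le⟩, rfl, ?_, ?_, ?_⟩
  · exact_mod_cast hξ0
  · ext; push_cast; exact fst_row_perronXi (ne_of_gt hb)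
  · ext; push_cast; exact snd_row_perronXi hb hc

/-- The same data transported to `ℝ≥0∞` (the currency of `max_step_le`), together with the
criterion `r < 1 ↔ a < 1 ∧ d < 1 ∧ bc < (1 − a)(1 − d)`.
[cite: ConacheEtAl2015, §3.3 (srM); §3.4 (dc11)] -/
theorem exists_weight_ennreal (a b c d : ℝ≥0) (hb : 0 < b) (hc : 0 < c) :
    ∃ r ξ : ℝ≥0, (r : ℝ) = perronRoot a b c d ∧ (ξ : ℝ≥0∞) ≠ 0 ∧ (ξ : ℝ≥0∞) ≠ ∞ ∧
      (a : ℝ≥0∞) + ξ * b ≤ r ∧ (c : ℝ≥0∞) + ξ * d ≤ ξ * r ∧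
      ((r : ℝ≥0∞) < 1 ↔ a < 1 ∧ d < 1 ∧ b * c < (1 - a) * (1 - d)) := by
  obtain ⟨r, ξ, hr, hξ, h1, h2⟩ := exists_weight_of_perronRoot a b c d hb hc
  refine ⟨r, ξ, hr, by exact_mod_cast hξ.ne', ENNReal.coe_ne_top, ?_, ?_, ?_⟩
  · exact_mod_cast h1.le
  · exact_mod_cast h2.le
  · have hbc : 0 ≤ (b : ℝ) * c := (mul_pos hb hc).le
    have key := perronRoot_lt_one_iff (a := (a : ℝ)) (d := (d : ℝ)) hbc
    rw [← hr] at key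
    have ha1 : (a : ℝ) < 1 ↔ a < 1 := by norm_cast
    have hd1 : (d : ℝ) < 1 ↔ d < 1 := by norm_cast
    constructor
    · intro h
      have h' : (r : ℝ) < 1 := by exact_mod_cast ENNReal.coe_lt_one_iff.1 h
      obtain ⟨h1, h2, h3⟩ := key.1 h'
      refine ⟨ha1.1 h1, hd1.1 h2, ?_⟩
      have ha' : a ≤ 1 := (ha1.1 h1).le
      have hd' : d ≤ 1 := (hd1.1 h2).le
      rw [← NNReal.coe_lt_coe]; push_cast [ha', hd']; exact h3
    · rintro ⟨h1, h2, h3⟩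
      have h3' : (b : ℝ) * c < (1 - a) * (1 - d) := by
        have := NNReal.coe_lt_coe.2 h3; push_cast [h1.le, h2.le] at this; exact this
      exact ENNReal.coe_lt_one_iff.2 (by exact_mod_cast key.2 ⟨ha1.2 h1, hd1.2 h2, h3'⟩)

end DobrushinPecherskyContraction

end Literature.Probability.TransportMaps
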